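import Literature.AlgebraicGeometry.Resolution.PointBlowupHilbertSamuelStrata
import Literature.AlgebraicGeometry.Resolution.GenericPointStalkData
import Literature.AlgebraicGeometry.Resolution.BlowupsFlatBaseChange
import Literature.AlgebraicGeometry.Resolution.BlowupsProperProofs
import Literature.AlgebraicGeometry.Resolution.HilbertSamuelLocal
import Literature.AlgebraicGeometry.Resolution.HilbertSamuelSemicontinuityRegular
import Literature.AlgebraicGeometry.Resolution.AlterationsSectionDivisor
import Literature.AlgebraicGeometry.Resolution.RegularLocusOpen
import Literature.AlgebraicGeometry.Resolution.ExcellentRingsFieldProofs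
import Literature.AlgebraicGeometry.Resolution.Temkin2008Localization
import Literature.AlgebraicGeometry.Resolution.NormalCrossingsLocal
import Mathlib.AlgebraicGeometry.Morphisms.Finite
import HarnessLib

/-!
# `H_{X'}(x') ≤ H_X(π x')` at EVERY point of the blow-up of a closed point
# (CJS 2020, Thm. 3.10 (1) for a closed-point centre: the hypothesis `hmono` of the termination theorem)

Topic: `Literature/AlgebraicGeometry/Resolution`. Cossart–Jannsen–Saito, LNM 2270, Thm. 3.10 (1)
("`H_{X'}(x') ≤ H_X(x)`") is used in the termination arguments (Thm. 6.17 ff.,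
`Scheme.no_infinite_hsFun_tower` of `HilbertSamuelValues.lean`, hypothesis `hmono`) at ALL
points `x'` of `X' = Bl_x(X)`. This file ASSEMBLES that inequality for the blow-up of a closed
point `x` of an integral scheme, for `N > ψ_X(x)`, and PROVES it outright for schemes locally of
finite type over a field (more generally: for a quasi-excellent `X` with `𝒪_{X,x}` universally
catenary, e.g. `X` excellent):

* off the fibre, `π` is a local isomorphism (`IsBlowup.isIso_compl`, Stacks 02OS), and `H^N` only
  depends on the local ring (`Scheme.hsFun_eq_of_isIso_stalkMap`);
* at the points of the fibre with finite residue extension — all closed points of `X'`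
  (`finite_residueFieldMap_of_isClosed`: for `π` locally of finite type and `y'` closed,
  `k(y')/k(π y')` is finite, Stacks 01TB) — `IsBlowup.hsFun_le_of_finite_residueFieldMap`
  (`PointBlowupHilbertSamuelStrata.lean`, the Bennett–Hironaka form of Thm. 3.10 (1) proved in
  `PointBlowupResiduallyFinite.lean`);
* at a non-closed point `a` of the fibre, CJS Thm. 2.33 (1) along the closure `cl{a}` at a closed
  point `b ∈ cl{a}` where `cl{a}` is REGULAR (`Scheme.hsFun_le_hsFun_of_specializes_of_isRegularLocalRing`,
  `HilbertSamuelSemicontinuityRegular.lean`: Bennett's inequality for a regular centre): such `b`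
  exists because the regular locus of the reduced closed subscheme `cl{a}` is open (J-2) and
  non-empty (it contains `a`), hence — the fibre `π⁻¹(x) ⊇ cl{a}` being closed and Jacobson —
  contains a closed point (`Scheme.exists_isClosed_specializes_hsFun_le`). So the general semi-continuity theorem
  (Bennett–Singh for singular closures) is NOT needed for `hmono`.

PROVED: `IsBlowup.isIso_stalkMap_of_ne`, `IsBlowup.hsFun_eq_of_ne` (off the fibre),
`exists_isClosed_and_specializes_of_jacobsonSpace`, `finite_residueFieldMap_of_isClosed`,
`isRegularLocalRing_stalk_subscheme_iff` (the local rings of `V(C)` are the `𝒪_{X,x}/C_x`),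
`Scheme.exists_isClosed_specializes_hsFun_le`, `isCatenaryRing_stalk_of_locallyOfFiniteType`,
`IsBlowup.hsFun_le_of_isClosed_point_centre'` (abstract assembly),
`IsBlowup.hsFun_le_of_isClosed_point_centre` (assembly from `h1` = Thm. 2.33 (1) on `X'`),
`IsBlowup.hsFun_le_of_isClosed_point_centre_of_isQuasiExcellent` (quasi-excellent `X`) and
`IsBlowup.hsFun_le_of_isClosed_point_centre_of_locallyOfFiniteType` (**`H^N_{X'}(x') ≤ H^N_X(π x')`
for all `x'`, unconditionally, for the blow-up of a closed point of an integral scheme locally of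
finite type over a field**), and `IsBlowup.hsFun_le_of_finite_closedPoints_centre_of_locallyOfFiniteType`
(the same for a finite set of closed points as centre, e.g. `X_max` of a normal surface, by
restriction to opens). No definitions and no named facts are introduced.

## Sources

* V. Cossart, U. Jannsen, S. Saito, LNM 2270 (2020), Thm. 3.10 (1) (p. 43–44), Thm. 2.33 (1)
  (p. 31), Thm. 6.17. [CossartJannsenSaito2020]
* The Stacks Project, Tags 02OS (blow-up is an iso off the centre), 01TB (closed points and
  morphisms locally of finite type over Jacobson schemes), 07QW. [StacksProject]
-/

noncomputable section

open CategoryTheory IsLocalRing Literature.RingTheory.HilbertSamuel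

namespace Literature.AlgebraicGeometry.Resolution

universe u

open _root_.AlgebraicGeometry

variable {X X' : Scheme.{u}} {π : X' ⟶ X} {x : X}

/-! ## Off the fibre -/

/-- **Off the centre a blow-up of the closed point `x` is a local isomorphism**: the stalk map
`𝒪_{X,π x'} → 𝒪_{X',x'}` is an isomorphism whenever `π x' ≠ x` (Stacks 02OS through
`IsBlowup.isIso_compl`). [cite: StacksProject, Tag 02OS] -/
theorem IsBlowup.isIso_stalkMap_of_ne (hx : IsClosed ({x} : Set X))
    (hπ : IsBlowup π (Scheme.IdealSheafData.vanishingIdeal ⟨{x}, hx⟩)) {x' : X'}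
    (hx' : π.base x' ≠ x) : IsIso (π.stalkMap x') := by
  haveI := hπ.isIso_compl
  refine isIso_stalkMap_of_isIso_morphismRestrict π
    ⟨((Scheme.IdealSheafData.vanishingIdeal ⟨{x}, hx⟩).support : Set X)ᶜ,
      (Scheme.IdealSheafData.vanishingIdeal ⟨{x}, hx⟩).support.isClosed.isOpen_compl⟩ x' ?_
  show π.base x' ∈ ((Scheme.IdealSheafData.vanishingIdeal ⟨{x}, hx⟩).support : Set X)ᶜ
  rw [Scheme.IdealSheafData.coe_support_vanishingIdeal]
  exact hx'

/-- Hence `H^N_{X'}(x') = H^N_X(π x')` for `π x' ≠ x`. [cite: CossartJannsenSaito2020, Def. 2.28; StacksProject, Tag 02OS] -/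
theorem IsBlowup.hsFun_eq_of_ne [IsLocallyNoetherian X] (hx : IsClosed ({x} : Set X))
    (hπ : IsBlowup π (Scheme.IdealSheafData.vanishingIdeal ⟨{x}, hx⟩)) {x' : X'}
    (hx' : π.base x' ≠ x) (N : ℕ) : Scheme.hsFun X' N x' = Scheme.hsFun X N (π.base x') := by
  haveI := hπ.isIso_stalkMap_of_ne hx hx'
  exact Scheme.hsFun_eq_of_isIso_stalkMap π N x'

/-! ## Closed specialisations and residue fields of closed points (Jacobson schemes) -/

/-- In a Jacobson space every point specialises to a closed point (schemes locally of finite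
type over a field or over `ℤ` are Jacobson). [folklore] -/
theorem exists_isClosed_and_specializes_of_jacobsonSpace {Y : Type*} [TopologicalSpace Y]
    [JacobsonSpace Y] (a : Y) : ∃ b : Y, IsClosed ({b} : Set Y) ∧ a ⤳ b := by
  obtain ⟨b, hbZ, hbcl⟩ := nonempty_inter_closedPoints (Z := closure ({a} : Set Y))
    ⟨a, subset_closure rfl⟩ isClosed_closure.isLocallyClosed
  exact ⟨b, hbcl, specializes_iff_mem_closure.mpr hbZ⟩

/-- **Closed points have finite residue extension along a morphism locally of finite type**
(Stacks 01TB): for `π : X' → X` locally of finite type and `y' ∈ X'` a closed point,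
`k(π y') → k(y')` is finite. Indeed `Spec k(y') → X'` is a closed immersion, hence locally of
finite type, hence so is `Spec k(y') → Spec k(π y')`, which is then finite (a field is Jacobson).
[cite: StacksProject, Tag 01TB] -/
theorem finite_residueFieldMap_of_isClosed (π : X' ⟶ X) [LocallyOfFiniteType π]
    {y' : X'} (hy' : IsClosed ({y'} : Set X')) :
    (IsLocalRing.ResidueField.map (π.stalkMap y').hom).Finite := by
  haveI : IsClosedImmersion (X'.fromSpecResidueField y') :=
    isClosed_singleton_iff_isClosedImmersion.mp hy'
  haveI : LocallyOfFiniteType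
      (Spec.map (π.residueFieldMap y') ≫ X.fromSpecResidueField (π.base y')) := by
    rw [Scheme.Hom.SpecMap_residueFieldMap_fromSpecResidueField]
    infer_instance
  haveI : LocallyOfFiniteType (Spec.map (π.residueFieldMap y')) :=
    locallyOfFiniteType_of_comp _ (X.fromSpecResidueField (π.base y'))
  haveI : IsJacobsonRing (X.residueField (π.base y')) :=
    inferInstanceAs (IsJacobsonRing (IsLocalRing.ResidueField (X.presheaf.stalk (π.base y'))))
  haveI : _root_.IsReduced (X'.residueField y') :=
    inferInstanceAs (_root_.IsReduced (IsLocalRing.ResidueField (X'.presheaf.stalk y')))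
  haveI : IsFinite (Spec.map (π.residueFieldMap y')) :=
    isFinite_iff_locallyOfFiniteType_of_jacobsonSpace.mpr inferInstance
  exact (IsFinite.SpecMap_iff _).mp this

/-! ## Regular points of the reduced closure of a point -/

/-- **The local rings of a closed subscheme `V(C)` are the quotient stalks `𝒪_{Y,s}/C_s`**: for a
point `s` of `V(C)`, `𝒪_{V(C),s}` is a regular local ring iff `𝒪_{Y,s}/C_s` is (the stalk map of
the closed immersion `V(C) → Y` is onto with kernel `C_s`). [folklore] -/
theorem isRegularLocalRing_stalk_subscheme_iff {Y : Scheme.{u}} (C : Y.IdealSheafData)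
    (s : C.subscheme) :
    IsRegularLocalRing (C.subscheme.presheaf.stalk s) ↔
      IsRegularLocalRing (Y.presheaf.stalk (C.subschemeι.base s) ⧸
        stalkIdeal C (C.subschemeι.base s)) := by
  have hsurj : Function.Surjective (C.subschemeι.stalkMap s).hom :=
    C.subschemeι.stalkMap_surjective s
  have hker : RingHom.ker (C.subschemeι.stalkMap s).hom = stalkIdeal C (C.subschemeι.base s) := by
    rw [← stalkIdeal_ker_eq_ker_stalkMap C.subschemeι s, Scheme.IdealSheafData.ker_subschemeι]
  let e : (Y.presheaf.stalk (C.subschemeι.base s) ⧸ stalkIdeal C (C.subschemeι.base s)) ≃+*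
      C.subscheme.presheaf.stalk s :=
    (Ideal.quotEquivOfEq hker.symm).trans (RingHom.quotientKerEquivOfSurjective hsurj)
  exact ⟨fun h => IsRegularLocalRing.of_ringEquiv e.symm, fun h => IsRegularLocalRing.of_ringEquiv e⟩

/-- **A non-closed point specialises, without decrease of `H_Y`, to a closed point.** Let `Y` be a
locally noetherian scheme, `a ∈ F ⊆ Y` with `F` closed and Jacobson (e.g. `F = Y` Jacobson, or `F`
the fibre over a closed point of a morphism locally of finite type), `Z = cl{a}` with its reduced
structure, and assume that the regular locus of `Z` is open (J-2, e.g. `Y` locally of finite type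
over a quasi-excellent scheme) and that the local rings of `Y` at the closed points of `Z` are
catenary. Then there is a closed point `b` with `a ⤳ b` and `H^N_Y(a) ≤ H^N_Y(b)`: the regular
locus of `Z` contains `a` (`𝒪_{Z,a} = k(a)`), is open in the closed set `Z ⊆ F`, hence contains a
closed point `b` of `F` (Jacobson), closed in `Y`, and at `b` CJS Thm. 2.33 (1) holds by Bennett's
inequality for the regular centre `𝒪_{Y,b}/𝔭_a = 𝒪_{Z,b}`
(`Scheme.hsFun_le_hsFun_of_specializes_of_isRegularLocalRing`).
[cite: CossartJannsenSaito2020, Thm. 2.33 (1)] -/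
theorem Scheme.exists_isClosed_specializes_hsFun_le {Y : Scheme.{u}} [IsLocallyNoetherian Y]
    (N : ℕ) (a : Y) {F : Set Y} (hF : IsClosed F) [JacobsonSpace F] (haF : a ∈ F)
    (hopen : IsOpen (Scheme.regularLocus
      (Scheme.IdealSheafData.vanishingIdeal
        (⟨closure ({a} : Set Y), isClosed_closure⟩ : TopologicalSpace.Closeds Y)).subscheme))
    (hcat : ∀ b : Y, IsClosed ({b} : Set Y) → a ⤳ b → IsCatenaryRing (Y.presheaf.stalk b)) :
    ∃ b : Y, IsClosed ({b} : Set Y) ∧ a ⤳ b ∧ Scheme.hsFun Y N a ≤ Scheme.hsFun Y N b := by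
  set C : Y.IdealSheafData := Scheme.IdealSheafData.vanishingIdeal
    (⟨closure ({a} : Set Y), isClosed_closure⟩ : TopologicalSpace.Closeds Y) with hC
  have hrange : Set.range C.subschemeι.base = closure ({a} : Set Y) := by
    have h := Scheme.IdealSheafData.range_subschemeι C
    rw [hC, Scheme.IdealSheafData.coe_support_vanishingIdeal] at h
    exact h
  have hemb : Topology.IsClosedEmbedding C.subschemeι.base := C.subschemeι.isClosedEmbedding
  -- the image `R` of `Reg Z` in `Y` is locally closed
  set R : Set Y := C.subschemeι.base '' Scheme.regularLocus C.subscheme with hR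
  have hRlc : IsLocallyClosed R := by
    obtain ⟨V, hV, hVeq⟩ := hemb.isInducing.isOpen_iff.mp hopen
    have : R = V ∩ Set.range C.subschemeι.base := by
      rw [hR, ← hVeq, Set.image_preimage_eq_inter_range]
    rw [this]
    exact hV.isLocallyClosed.inter hemb.isClosed_range.isLocallyClosed
  -- `a ∈ R`: `𝒪_{Z,a} ≅ 𝒪_{Y,a}/𝔪_a` is a field
  have haR : a ∈ R := by
    obtain ⟨s, hs⟩ : a ∈ Set.range C.subschemeι.base := by
      rw [hrange]; exact subset_closure rfl
    refine ⟨s, ?_, hs⟩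
    show IsRegularLocalRing (C.subscheme.presheaf.stalk s)
    rw [isRegularLocalRing_stalk_subscheme_iff C s]
    have hI : stalkIdeal C (C.subschemeι.base s) = maximalIdeal (Y.presheaf.stalk (C.subschemeι.base s)) := by
      rw [hs, hC]
      exact stalkIdeal_vanishingIdeal_closure_self a
    rw [hI]
    exact isRegularLocalRing_of_isField
      ((Ideal.Quotient.maximal_ideal_iff_isField_quotient _).mp inferInstance)
  -- a closed point `b ∈ R`: `R ⊆ cl{a} ⊆ F` is locally closed in the Jacobson space `F`
  have hRlc' : IsLocallyClosed ((Subtype.val : F → Y) ⁻¹' R) := hRlc.preimage continuous_subtype_val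
  obtain ⟨b', hb'R, hb'cl⟩ := nonempty_inter_closedPoints ⟨⟨a, haF⟩, haR⟩ hRlc'
  have hbcl : IsClosed ({(b' : Y)} : Set Y) := by
    have h := hF.isClosedEmbedding_subtypeVal.isClosedMap _ hb'cl
    rwa [Set.image_singleton] at h
  obtain ⟨s, hsreg, hsb⟩ : (b' : Y) ∈ R := hb'R
  rw [← hsb] at hbcl
  have hab : a ⤳ C.subschemeι.base s := by
    have hmem : C.subschemeι.base s ∈ closure ({a} : Set Y) := by
      rw [← hrange]; exact ⟨s, rfl⟩
    exact specializes_iff_mem_closure.mpr hmem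
  -- `𝒪_{Y,b}/𝔭_a = 𝒪_{Z,b}` is regular
  haveI : IsRegularLocalRing (Y.presheaf.stalk (C.subschemeι.base s) ⧸ primeOfSpecializes hab) := by
    rw [← stalkIdeal_vanishingIdeal_closure hab]
    exact (isRegularLocalRing_stalk_subscheme_iff C s).mp hsreg
  exact ⟨_, hbcl, hab,
    Scheme.hsFun_le_hsFun_of_specializes_of_isRegularLocalRing N hab (hcat _ hbcl hab)⟩

/-- The openness hypothesis of `Scheme.exists_isClosed_specializes_hsFun_le` for a scheme
locally of finite type over a quasi-excellent scheme (J-2 for the closed subscheme `V(C) → Y → S`,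
`isOpen_regularLocus_of_locallyOfFiniteType`). [cite: Matsumura1987, §32 p. 260 Definition] -/
theorem isOpen_regularLocus_subscheme_of_locallyOfFiniteType {Y S : Scheme.{u}} (g : Y ⟶ S)
    [LocallyOfFiniteType g] (hS : Scheme.IsQuasiExcellent S) (C : Y.IdealSheafData) :
    IsOpen (Scheme.regularLocus C.subscheme) :=
  isOpen_regularLocus_of_locallyOfFiniteType (C.subschemeι ≫ g) hS

/-- **The local rings of a scheme locally of finite type over a point with universally catenary
local ring are catenary**: for `g : Y → S` locally of finite type and `y ∈ Y`, if `𝒪_{S,g y}` is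
universally catenary then `𝒪_{Y,y}` is catenary (`𝒪_{Y,y}` is essentially of finite type over
`𝒪_{S,g y}`, Stacks 00NJ). [cite: StacksProject, Tag 00NJ] -/
theorem isCatenaryRing_stalk_of_locallyOfFiniteType {Y S : Scheme.{u}} (g : Y ⟶ S)
    [LocallyOfFiniteType g] (y : Y) (hUC : IsUniversallyCatenaryRing (S.presheaf.stalk (g.base y))) :
    IsCatenaryRing (Y.presheaf.stalk y) := by
  letI := (g.stalkMap y).hom.toAlgebra
  exact hUC.isCatenaryRing_of_essFiniteType (LocallyOfFiniteType.stalkMap g y)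

/-! ## Assembly: `H^N_{X'}(x') ≤ H^N_X(π x')` at every point -/

/-- **CJS Thm. 3.10 (1) for the blow-up of a closed point, at every point of `X'` — abstract
assembly.** Let `X` be integral and locally Noetherian, `x ∈ X` a closed point with `𝒪_{X,x}`
universally catenary and `I({x}) ≠ 0` (i.e. `X ≠ {x}`), `π : X' → X` a blow-up of `x`
(`IsBlowup π I({x})`), and `N > ψ_X(x)`. Assume: (`hsp`) every point of the fibre specialises,
without decrease of `H^N_{X'}`, to a closed point; (`hfin`) the closed points of `X'` over `x` have
residue field finite over `k(x)`. Then `H^N_{X'}(x') ≤ H^N_X(π x')` for every `x' ∈ X'`: off the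
fibre this is an equality (`IsBlowup.hsFun_eq_of_ne`); on the fibre
`H^N_{X'}(x') ≤ H^N_{X'}(y') ≤ H^N_X(x)` for a closed specialisation `y'` of `x'` in the (closed)
fibre, by the Bennett–Hironaka inequality `IsBlowup.hsFun_le_of_finite_residueFieldMap`.
[cite: CossartJannsenSaito2020, Thm. 3.10 (1) (p. 44)] -/
theorem IsBlowup.hsFun_le_of_isClosed_point_centre' [IsIntegral X] [IsLocallyNoetherian X]
    [IsLocallyNoetherian X'] (hx : IsClosed ({x} : Set X))
    (hπ : IsBlowup π (Scheme.IdealSheafData.vanishingIdeal ⟨{x}, hx⟩))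
    (hJ0 : Scheme.IdealSheafData.vanishingIdeal ⟨{x}, hx⟩ ≠ ⊥)
    (hUC : IsUniversallyCatenaryRing (X.presheaf.stalk x)) (N : ℕ) (hN : Scheme.hsPsi X x < N)
    (hsp : ∀ a : X', π.base a = x →
      ∃ b : X', IsClosed ({b} : Set X') ∧ a ⤳ b ∧ Scheme.hsFun X' N a ≤ Scheme.hsFun X' N b)
    (hfin : ∀ y' : X', IsClosed ({y'} : Set X') → π.base y' = x →
      (ResidueField.map (π.stalkMap y').hom).Finite)
    (x' : X') : Scheme.hsFun X' N x' ≤ Scheme.hsFun X N (π.base x') := by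
  by_cases hx' : π.base x' = x
  · -- on the fibre: specialise to a closed point of the fibre
    obtain ⟨y', hy'cl, hxy', hle⟩ := hsp x' hx'
    have hπy' : π.base y' = x := by
      have hsp' : π.base x' ⤳ π.base y' := hxy'.map π.base.hom.continuous
      rw [hx'] at hsp'
      have hmem : π.base y' ∈ closure ({x} : Set X) := hsp'.mem_closure
      rw [hx.closure_eq] at hmem
      exact hmem
    have hJ : stalkIdeal (Scheme.IdealSheafData.vanishingIdeal ⟨{x}, hx⟩) (π.base y') =
        maximalIdeal (X.presheaf.stalk (π.base y')) := by
      have hcl' : (⟨{x}, hx⟩ : TopologicalSpace.Closeds X) = ⟨closure {x}, isClosed_closure⟩ :=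
        TopologicalSpace.Closeds.ext hx.closure_eq.symm
      rw [hπy', hcl']
      exact stalkIdeal_vanishingIdeal_closure_self x
    have hUC' : IsUniversallyCatenaryRing (X.presheaf.stalk (π.base y')) := by rw [hπy']; exact hUC
    have hN' : Scheme.hsPsi X (π.base y') < N := by rw [hπy']; exact hN
    calc Scheme.hsFun X' N x' ≤ Scheme.hsFun X' N y' := hle
      _ ≤ Scheme.hsFun X N (π.base y') :=
          hπ.hsFun_le_of_finite_residueFieldMap hJ0 y' hUC' hJ (hfin y' hy'cl hπy') N hN'
      _ = Scheme.hsFun X N (π.base x') := by rw [hπy', hx']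
  · exact (hπ.hsFun_eq_of_ne hx hx' N).le

/-- **CJS Thm. 3.10 (1) for the blow-up of a closed point, at every point of `X'`**, from the
semi-continuity of `H_{X'}` (`h1`, CJS Thm. 2.33 (1) on `X'`, exactly as the hypothesis of
`Scheme.husc_and_finite_of_specializes`), the existence of closed specialisations (`hcl`,
automatic on Jacobson or quasi-compact schemes) and `hfin` as above.
[cite: CossartJannsenSaito2020, Thm. 3.10 (1) (p. 44), Thm. 2.33 (1)] -/
theorem IsBlowup.hsFun_le_of_isClosed_point_centre [IsIntegral X] [IsLocallyNoetherian X]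
    [IsLocallyNoetherian X'] (hx : IsClosed ({x} : Set X))
    (hπ : IsBlowup π (Scheme.IdealSheafData.vanishingIdeal ⟨{x}, hx⟩))
    (hJ0 : Scheme.IdealSheafData.vanishingIdeal ⟨{x}, hx⟩ ≠ ⊥)
    (hUC : IsUniversallyCatenaryRing (X.presheaf.stalk x)) (N : ℕ) (hN : Scheme.hsPsi X x < N)
    (h1 : ∀ a b : X', b ⤳ a → Scheme.hsFun X' N b ≤ Scheme.hsFun X' N a)
    (hcl : ∀ a : X', ∃ b : X', IsClosed ({b} : Set X') ∧ a ⤳ b)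
    (hfin : ∀ y' : X', IsClosed ({y'} : Set X') → π.base y' = x →
      (ResidueField.map (π.stalkMap y').hom).Finite)
    (x' : X') : Scheme.hsFun X' N x' ≤ Scheme.hsFun X N (π.base x') :=
  hπ.hsFun_le_of_isClosed_point_centre' hx hJ0 hUC N hN
    (fun a _ => by
      obtain ⟨b, hb, hab⟩ := hcl a
      exact ⟨b, hb, hab, h1 b a hab⟩)
    hfin x'

/-- **CJS Thm. 3.10 (1) for the blow-up of a closed point of a quasi-excellent scheme, at every
point of `X'`.** Let `X` be integral, locally Noetherian and quasi-excellent, `x ∈ X` a closed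
point with `𝒪_{X,x}` universally catenary (e.g. `X` excellent), `π : X' → X` a blow-up of `x`, and
`N > ψ_X(x)`. Then `H^N_{X'}(x') ≤ H^N_X(π x')` for every `x' ∈ X'`. (`π` is proper, so: `X'` is
locally Noetherian; the closed points of `X'` have finite residue extensions; the fibre `π⁻¹(x)` is
closed and Jacobson; closures of points of `X'` have open regular loci; the local rings of `X'` at
the points of the fibre are catenary.) [cite: CossartJannsenSaito2020, Thm. 3.10 (1) (p. 44)] -/
theorem IsBlowup.hsFun_le_of_isClosed_point_centre_of_isQuasiExcellent [IsIntegral X]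
    [IsLocallyNoetherian X] (hqe : Scheme.IsQuasiExcellent X) (hx : IsClosed ({x} : Set X))
    (hπ : IsBlowup π (Scheme.IdealSheafData.vanishingIdeal ⟨{x}, hx⟩))
    (hUC : IsUniversallyCatenaryRing (X.presheaf.stalk x)) (N : ℕ) (hN : Scheme.hsPsi X x < N)
    (x' : X') : Scheme.hsFun X' N x' ≤ Scheme.hsFun X N (π.base x') := by
  -- if `I({x}) = 0` (i.e. `X = {x}`) the blow-up is empty and there is nothing to prove
  by_cases hJ0 : Scheme.IdealSheafData.vanishingIdeal ⟨{x}, hx⟩ = ⊥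
  · rw [hJ0] at hπ
    exact ((IsBlowup.isEmpty_of_bot hπ).false x').elim
  haveI : IsProper π := hπ.isProper
  haveI : IsLocallyNoetherian X' := LocallyOfFiniteType.isLocallyNoetherian π
  -- the fibre over the closed point `x` is closed and Jacobson
  have hF : IsClosed (π.base ⁻¹' ({x} : Set X)) := hx.preimage π.base.hom.continuous
  haveI : JacobsonSpace (π.base ⁻¹' ({x} : Set X)) :=
    .of_isClosedEmbedding (π.fiberHomeo x).symm.isClosedEmbedding
  refine hπ.hsFun_le_of_isClosed_point_centre' hx hJ0 hUC N hN (fun a ha => ?_)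
    (fun y' hy' _ => finite_residueFieldMap_of_isClosed π hy') x'
  refine Scheme.exists_isClosed_specializes_hsFun_le N a hF ha
    (isOpen_regularLocus_subscheme_of_locallyOfFiniteType π hqe _) (fun b _ hab => ?_)
  -- `b` lies in the (closed) fibre over `x`, so `𝒪_{X,π b} = 𝒪_{X,x}` is universally catenary
  have hπb : π.base b = x := by
    have hsp' : π.base a ⤳ π.base b := hab.map π.base.hom.continuous
    rw [show π.base a = x from ha] at hsp'
    have hmem : π.base b ∈ closure ({x} : Set X) := hsp'.mem_closure
    rw [hx.closure_eq] at hmem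
    exact hmem
  have hUCb : IsUniversallyCatenaryRing (X.presheaf.stalk (π.base b)) := by rw [hπb]; exact hUC
  exact isCatenaryRing_stalk_of_locallyOfFiniteType π b hUCb

/-- **CJS Thm. 3.10 (1) for the blow-up of a closed point of a scheme locally of finite type over
a field, at every point of `X'` — unconditionally.** Let `k` be a field, `X` an integral scheme
locally of finite type over `k`, `x ∈ X` a closed point, `π : X' → X` a blow-up of `x`
(`IsBlowup π I({x})`), and `N > ψ_X(x)` (`= dim 𝒪_{X,x}`). Then
`H^N_{X'}(x') ≤ H^N_X(π x')` for every `x' ∈ X'` — the hypothesis `hmono` of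
`Scheme.no_infinite_hsFun_tower` for this blow-up. (`X` is excellent by Stacks 07QW,
`Stacks07QW_field_holds`.) [cite: CossartJannsenSaito2020, Thm. 3.10 (1) (p. 44)]
[cite: StacksProject, Tag 07QW] -/
theorem IsBlowup.hsFun_le_of_isClosed_point_centre_of_locallyOfFiniteType {k : Type u} [Field k]
    [IsIntegral X] (f : X ⟶ Spec (.of k)) [LocallyOfFiniteType f]
    (hx : IsClosed ({x} : Set X))
    (hπ : IsBlowup π (Scheme.IdealSheafData.vanishingIdeal ⟨{x}, hx⟩)) (N : ℕ)
    (hN : Scheme.hsPsi X x < N) (x' : X') :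
    Scheme.hsFun X' N x' ≤ Scheme.hsFun X N (π.base x') := by
  haveI : IsLocallyNoetherian X := LocallyOfFiniteType.isLocallyNoetherian f
  have hexc : Scheme.IsExcellent X := Scheme.isExcellent_of_locallyOfFiniteType Stacks07QW_field_holds f
  exact hπ.hsFun_le_of_isClosed_point_centre_of_isQuasiExcellent hexc.isQuasiExcellent hx
    (hexc.isUniversallyCatenaryRing_stalk x) N hN x'


/-! ## Finite sets of closed points as centre (the first blow-up `Bl_{X_max}(X)` of the CJS strategy) -/

/-- **Off a closed centre `Z` a blow-up along `I(Z)` is a local isomorphism**: the stalk map at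
`x'` is an isomorphism whenever `π x' ∉ Z` (Stacks 02OS through `IsBlowup.isIso_compl`).
[cite: StacksProject, Tag 02OS] -/
theorem IsBlowup.isIso_stalkMap_of_not_mem_vanishingIdeal {Z : TopologicalSpace.Closeds X}
    (hπ : IsBlowup π (Scheme.IdealSheafData.vanishingIdeal Z)) {x' : X'}
    (hx' : π.base x' ∉ Z) : IsIso (π.stalkMap x') := by
  haveI := hπ.isIso_compl
  refine isIso_stalkMap_of_isIso_morphismRestrict π
    ⟨((Scheme.IdealSheafData.vanishingIdeal Z).support : Set X)ᶜ,
      (Scheme.IdealSheafData.vanishingIdeal Z).support.isClosed.isOpen_compl⟩ x' ?_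
  show π.base x' ∈ ((Scheme.IdealSheafData.vanishingIdeal Z).support : Set X)ᶜ
  rw [Scheme.IdealSheafData.coe_support_vanishingIdeal]
  exact hx'

/-- Hence `H^N_{X'}(x') = H^N_X(π x')` for `π x' ∉ Z`.
[cite: CossartJannsenSaito2020, Def. 2.28; StacksProject, Tag 02OS] -/
theorem IsBlowup.hsFun_eq_of_not_mem [IsLocallyNoetherian X] {Z : TopologicalSpace.Closeds X}
    (hπ : IsBlowup π (Scheme.IdealSheafData.vanishingIdeal Z)) {x' : X'}
    (hx' : π.base x' ∉ Z) (N : ℕ) : Scheme.hsFun X' N x' = Scheme.hsFun X N (π.base x') := by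
  haveI := hπ.isIso_stalkMap_of_not_mem_vanishingIdeal hx'
  exact Scheme.hsFun_eq_of_isIso_stalkMap π N x'

/-- A finite set of closed points is closed. [folklore] -/
theorem isClosed_of_finite_of_forall_isClosed_singleton {Y : Type*} [TopologicalSpace Y]
    {D : Set Y} (hfin : D.Finite) (hcl : ∀ y ∈ D, IsClosed ({y} : Set Y)) : IsClosed D := by
  have h := hfin.isClosed_biUnion fun y hy => hcl y hy
  rwa [Set.biUnion_of_singleton] at h

/-- **CJS Thm. 3.10 (1) for the blow-up of a finite set of closed points of a scheme locally of
finite type over a field, at every point of `X'` — unconditionally.** Let `k` be a field, `X` an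
integral scheme locally of finite type over `k`, `D ⊂ X` a finite set of closed points (e.g. the
Hilbert–Samuel locus `X_max` of a normal surface, the centre of the first blow-up of the CJS
strategy, Rem. 6.29), `π : X' → X` a blow-up along `I(D)` (`IsBlowup π I(D)`), and `N > ψ_X(y)`
for all `y ∈ D`. Then `H^N_{X'}(x') ≤ H^N_X(π x')` for every `x' ∈ X'` (the hypothesis `hmono` of
`Scheme.no_infinite_hsFun_tower`). Over the open `U = X ∖ (D ∖ {x})`, `x = π x'`, the blow-up
restricts to the blow-up of `U` at the closed point `x` (`IsBlowup.restrict`,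
`comap_vanishingIdeal_of_isOpenImmersion`), where
`IsBlowup.hsFun_le_of_isClosed_point_centre_of_locallyOfFiniteType` applies; `H^N` is local
(`Scheme.hsFun_opens`). [cite: CossartJannsenSaito2020, Thm. 3.10 (1) (p. 44), Rem. 6.29] -/
theorem IsBlowup.hsFun_le_of_finite_closedPoints_centre_of_locallyOfFiniteType {k : Type u}
    [Field k] [IsIntegral X] (f : X ⟶ Spec (.of k)) [LocallyOfFiniteType f] {D : Set X}
    (hDfin : D.Finite) (hDcl : ∀ y ∈ D, IsClosed ({y} : Set X)) (hD : IsClosed D)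
    (hπ : IsBlowup π (Scheme.IdealSheafData.vanishingIdeal ⟨D, hD⟩)) (N : ℕ)
    (hN : ∀ y ∈ D, Scheme.hsPsi X y < N) (x' : X') :
    Scheme.hsFun X' N x' ≤ Scheme.hsFun X N (π.base x') := by
  haveI : IsLocallyNoetherian X := LocallyOfFiniteType.isLocallyNoetherian f
  haveI : IsProper π := hπ.isProper
  haveI : IsLocallyNoetherian X' := LocallyOfFiniteType.isLocallyNoetherian π
  by_cases hx'D : π.base x' ∈ D
  swap
  · exact (hπ.hsFun_eq_of_not_mem (Z := ⟨D, hD⟩) hx'D N).le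
  -- `U = X ∖ (D ∖ {x})`, `x = π x'`
  have hcl : IsClosed (D \ {π.base x'}) :=
    isClosed_of_finite_of_forall_isClosed_singleton (hDfin.subset Set.sdiff_subset)
      fun y hy => hDcl y hy.1
  let U : X.Opens := ⟨(D \ {π.base x'})ᶜ, hcl.isOpen_compl⟩
  have hxU : π.base x' ∈ U := fun h => h.2 rfl
  have hx'U : x' ∈ π ⁻¹ᵁ U := hxU
  -- the closed point `xU` of `U` over `x`
  obtain ⟨xU, hxUeq⟩ : ∃ xU : (U : Scheme.{u}), U.ι.base xU = π.base x' := ⟨⟨π.base x', hxU⟩, rfl⟩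
  have hinj : Function.Injective U.ι.base := U.ι.isOpenEmbedding.injective
  have h1 : ({xU} : Set (U : Scheme.{u})) = U.ι.base ⁻¹' {π.base x'} := by
    ext u
    simp only [Set.mem_singleton_iff, Set.mem_preimage]
    rw [← hxUeq]
    exact ⟨fun h => h ▸ rfl, fun h => hinj h⟩
  have hxUcl : IsClosed ({xU} : Set (U : Scheme.{u})) := by
    rw [h1]
    exact (hDcl _ hx'D).preimage U.ι.base.hom.continuous
  -- `U ∩ D = {x}`
  have hpre : (⟨D, hD⟩ : TopologicalSpace.Closeds X).preimage U.ι.continuous = ⟨{xU}, hxUcl⟩ := by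
    ext u
    change U.ι.base u ∈ D ↔ u ∈ ({xU} : Set (U : Scheme.{u}))
    rw [h1, Set.mem_preimage, Set.mem_singleton_iff]
    refine ⟨fun hu => ?_, fun hu => hu ▸ hx'D⟩
    have huU : U.ι.base u ∈ (U : Set X) := by
      rw [← Scheme.Opens.range_ι]
      exact ⟨u, rfl⟩
    by_contra hne
    exact huU ⟨hu, hne⟩
  -- the restricted blow-up is the blow-up of `U` at `xU`
  have hπU : IsBlowup (π ∣_ U) (Scheme.IdealSheafData.vanishingIdeal ⟨{xU}, hxUcl⟩) := by
    have h := hπ.restrict U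
    rwa [comap_vanishingIdeal_of_isOpenImmersion, hpre] at h
  haveI : Nonempty (U : Scheme.{u}) := ⟨xU⟩
  haveI : IsIntegral (U : Scheme.{u}) := isIntegral_of_isOpenImmersion U.ι
  have hψ : Scheme.hsPsi (U : Scheme.{u}) xU = Scheme.hsPsi X (π.base x') := by
    rw [← hxUeq]
    exact Scheme.hsPsi_eq_of_isIso_stalkMap U.ι xU
  have key := hπU.hsFun_le_of_isClosed_point_centre_of_locallyOfFiniteType (U.ι ≫ f) hxUcl N
    (by rw [hψ]; exact hN _ hx'D) ⟨x', hx'U⟩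
  rw [Scheme.hsFun_opens (π ⁻¹ᵁ U) N ⟨x', hx'U⟩, Scheme.hsFun_opens U N] at key
  have h2 : U.ι.base ((π ∣_ U).base ⟨x', hx'U⟩) = π.base x' :=
    morphismRestrict_base_coe π U ⟨x', hx'U⟩
  rw [h2] at key
  exact key

end Literature.AlgebraicGeometry.Resolution

end
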